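/-
Copyright: b2b-lace packet (tail-bound analyst, gen 8). The `n = 0` companion of the cell-sup layer
(`SrwIntegralSortedMonotone`, `SrwIntegralTUCellSup`): `L_0(x) ≤ 1/(2d)` for every `x ≠ 0`, by a
stabiliser count in the signed-permutation group `W_d`, and the Cauchy–Schwarz cell sups of
`K_{0,l}` and `U_{0,l}` it yields. `d`-generic; no numerical input; nothing cited as a fact.
-/
import Literature.Probability.FitznerVanDerHofstad2017.SrwIntegralMonotone
import Literature.Probability.FitznerVanDerHofstad2017.SrwIntegralV
import HarnessLib

/-!
# `L_0(x) ≤ 1/(2d)` off the origin: the `n = 0` cell sups of `K_{0,l}` and `U_{0,l}`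

The sorted-monotone cell sups of `SrwIntegralSortedMonotone` / `SrwIntegralTUCellSup` need `n ≥ 1`
([HS92b] Lemma B.3 does not extend to `n = 0`: `I_{0,l}` is the parity-constrained SRW transition
function, not monotone in `|x_μ|`).
At `n = 0` the quantity controlling `K_{0,l}(x)` and `U_{0,l}(x)` through [NoBLE16, (5.9)] is
`L_0(x) = ∫ (D̂^{(x)})² dk/(2π)^d`, and this file proves the sharp blanket bound

  `L_0(x) ≤ 1/(2d)`  for every `x ∈ ℤ^d ∖ {0}`, `d ≥ 1`  (`srwL_zero_le`; equality holds at `x = N e_i`,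
  since `L_0(e₁) = I_{0,2}(0) = 1/(2d)` — not needed and not proved here),

hence `K_{0,l}(x) ≤ √I_{0,2l}(0) · √(1/(2d))` (`srwK_zero_le_of_ne_zero`; `K_{0,0}(x) ≤ √(1/(2d))`,
`srwK_zero_zero_le_of_ne_zero`) and `U_{0,l}(x) ≤ √V_{0,2l} · √(1/(2d))`
(`srwU_zero_le_of_ne_zero`), uniformly in `x ≠ 0` — in particular on the cell `Q = {‖x‖₁ ≥ 3}` of
the `f₃` bound, where `BoundH[4]` at the index `n = 0` reads `K_{0,0}` ([NoBLE16, (3.78)]). At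
`d = 11` the right side `1/√22` coincides with the tables' node value `√(I_{0,0}(0) · L_0(3e₁))`, so
the blanket bound loses nothing against the node maximum.

Proof. `I_{0,0}(y) = [y = 0]` (`srwI_zero_zero_apply`), so the placement formula (5.16) gives
`L_0(x) = W_{0,0}(x) = #{ρ ∈ W_d : ρx = x} / (2^d d!)` (`srwL_zero_eq_card_stab`). For `x ≠ 0`
pick `i₀` with `x_{i₀} ≠ 0`. A stabilising `ρ = (π, δ)` (`(ρx)_i = δ_i x_{π i}`) has `x_{π i₀} ≠ 0`,
and its signs are forced on the support of `x`; so `ρ ↦ (π, δ off the support)` injects the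
stabiliser into `{π : x_{π i₀} ≠ 0} × {δ : δ = 1 on supp x}` (`card_stab_le`), a set of size
`s · (d-1)! · 2^{d-s}` with `s = #supp x ≥ 1` (`mul_card_perm_support`, `card_signs_fixed_le`), and
`2d · s (d-1)! · 2^{d-s} = 2s · 2^{d-s} · d! ≤ 2^d · d!` because `2s ≤ 2^s`
(`two_mul_card_stab_le`).

[cite: FitznerVanDerHofstad2016NoBLE, (5.9) p. 1091, (5.16) p. 1092, (3.78) p. 1077]
-/

namespace Literature.Probability.FitznerVanDerHofstad2017

open MeasureTheory Real Finset
open Literature.Barriers.CriticalPhenomena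
open Literature.Barriers.CriticalPhenomena.Slade2006Prop53 (P)

variable {d : ℕ}

/-! ### `|W_d|`, `I_{0,0} = δ_0`, and `L_0` as a stabiliser count -/

/-- `|W_d| = 2^d · d!` (natural-number form). [cite: FitznerVanDerHofstad2016NoBLE, Def. 2.5 p. 1058] -/
theorem card_sgnPermPair_nat (d : ℕ) : Fintype.card (SgnPermPair d) = 2 ^ d * d.factorial := by
  rw [Fintype.card_prod, Fintype.card_perm, Fintype.card_fun, Fintype.card_units_int,
    Fintype.card_fin, mul_comm]

/-- `I_{0,0}(y) = 1` if `y = 0` and `= 0` otherwise (`p_0 = δ_0`, averaged over `W_d`). [folklore] -/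
theorem srwI_zero_zero_apply (y : Fin d → ℤ) : srwI d 0 0 y = if y = 0 then 1 else 0 := by
  rw [srwI_zero_eq_sum_srwP]
  have hN : (2 : ℝ) ^ d * (d.factorial : ℝ) ≠ 0 := by positivity
  have hc : ((Finset.univ : Finset (SgnPermPair d)).card : ℝ) = 2 ^ d * (d.factorial : ℝ) := by
    rw [Finset.card_univ, card_sgnPermPair_nat]; push_cast; ring
  by_cases hy : y = 0
  · have h1 : ∀ σ : SgnPermPair d, srwP d 0 (spAct σ y) = 1 := fun σ => by
      rw [srwP_zero, if_pos ((spAct_eq_zero_iff σ y).mpr hy)]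
    rw [Finset.sum_congr rfl fun σ _ => h1 σ, Finset.sum_const, nsmul_eq_mul, mul_one, hc,
      if_pos hy]
    exact div_self hN
  · have h0 : ∀ σ : SgnPermPair d, srwP d 0 (spAct σ y) = 0 := fun σ => by
      rw [srwP_zero, if_neg (mt (spAct_eq_zero_iff σ y).mp hy)]
    rw [Finset.sum_congr rfl fun σ _ => h0 σ, Finset.sum_const_zero, zero_div, if_neg hy]

/-- `L_0(x) = #{ρ ∈ W_d : ρ x = x} / (2^d d!)` — the placement formula (5.16) at `n = j = 0` with
`I_{0,0} = δ_0`. [cite: FitznerVanDerHofstad2016NoBLE, (5.16) p. 1092] -/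
theorem srwL_zero_eq_card_stab (hd : 1 ≤ d) (x : Fin d → ℤ) :
    srwL d 0 x = ((univ.filter fun ρ : SgnPermPair d => spAct ρ x = x).card : ℝ) / (2 ^ d * (d.factorial : ℝ)) := by
  rw [← srwW_zero, srwW_eq_orbit_sum (n := 0) (by omega) 0 x]
  congr 1
  have hsum : ∀ ρ : SgnPermPair d,
      srwI d 0 (2 * 0) (x - spAct ρ x) = if spAct ρ x = x then (1 : ℝ) else 0 := by
    intro ρ
    rw [mul_zero, srwI_zero_zero_apply]
    by_cases h : spAct ρ x = x
    · rw [if_pos (sub_eq_zero.mpr h.symm), if_pos h]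
    · rw [if_neg (fun e => h (sub_eq_zero.mp e).symm), if_neg h]
  rw [Finset.sum_congr rfl fun ρ _ => hsum ρ, Finset.sum_boole]

/-! ### The stabiliser count `2d · #Stab(x) ≤ 2^d · d!` -/

/-- All fibres of `π ↦ π i₀` on `Perm (Fin d)` have the same size. [folklore] -/
theorem card_perm_fin_apply_eq (i₀ j : Fin d) :
    (univ.filter fun τ : Equiv.Perm (Fin d) => τ i₀ = j).card =
      (univ.filter fun τ : Equiv.Perm (Fin d) => τ i₀ = i₀).card := by
  refine Finset.card_nbij' (fun τ => Equiv.swap i₀ j * τ) (fun τ => Equiv.swap i₀ j * τ)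
    ?_ ?_ ?_ ?_
  · intro τ hπ
    simp only [Finset.mem_coe, Finset.mem_filter, Finset.mem_univ, true_and] at hπ ⊢
    rw [Equiv.Perm.mul_apply, hπ, Equiv.swap_apply_right]
  · intro τ hπ
    simp only [Finset.mem_coe, Finset.mem_filter, Finset.mem_univ, true_and] at hπ ⊢
    rw [Equiv.Perm.mul_apply, hπ, Equiv.swap_apply_left]
  · intro τ _
    show Equiv.swap i₀ j * (Equiv.swap i₀ j * τ) = τ
    rw [← mul_assoc, Equiv.swap_mul_self, one_mul]
  · intro τ _
    show Equiv.swap i₀ j * (Equiv.swap i₀ j * τ) = τ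
    rw [← mul_assoc, Equiv.swap_mul_self, one_mul]

/-- `d · #{π : π i₀ = i₀} = d!`. [folklore] -/
theorem mul_card_perm_fin_fix (i₀ : Fin d) :
    d * (univ.filter fun τ : Equiv.Perm (Fin d) => τ i₀ = i₀).card = d.factorial := by
  have hmaps : Set.MapsTo (fun τ : Equiv.Perm (Fin d) => τ i₀)
      (↑(univ : Finset (Equiv.Perm (Fin d)))) (↑(univ : Finset (Fin d))) :=
    fun τ _ => Finset.mem_coe.mpr (Finset.mem_univ _)
  have h := Finset.card_eq_sum_card_fiberwise hmaps
  rw [Finset.card_univ, Fintype.card_perm, Fintype.card_fin] at h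
  have hfib : ∀ j ∈ (univ : Finset (Fin d)),
      ((univ : Finset (Equiv.Perm (Fin d))).filter fun τ => τ i₀ = j).card =
        (univ.filter fun τ : Equiv.Perm (Fin d) => τ i₀ = i₀).card :=
    fun j _ => card_perm_fin_apply_eq i₀ j
  rw [h, Finset.sum_congr rfl hfib, Finset.sum_const, Finset.card_univ, Fintype.card_fin,
    smul_eq_mul]

/-- A stabilising `ρ = (π, δ)` of `x` has `x_{π i₀} ≠ 0` whenever `x_{i₀} ≠ 0`, and its signs are
forced on the support of `x`: `#Stab(x) ≤ #{π : x_{π i₀} ≠ 0} · #{δ : δ = 1 on supp x}`. [folklore] -/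
theorem card_stab_le (x : Fin d → ℤ) (i₀ : Fin d) (hi₀ : x i₀ ≠ 0) :
    (univ.filter fun ρ : SgnPermPair d => spAct ρ x = x).card ≤
      (univ.filter fun τ : Equiv.Perm (Fin d) => x (τ i₀) ≠ 0).card *
        (univ.filter fun δ : Fin d → ℤˣ => ∀ i, x i ≠ 0 → δ i = 1).card := by
  rw [← Finset.card_product]
  refine Finset.card_le_card_of_injOn (fun ρ => (ρ.1, fun i => if x i = 0 then ρ.2 i else 1))
    ?_ ?_
  · intro ρ hρ
    have hρ' : spAct ρ x = x := by
      have := Finset.mem_coe.mp hρ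
      simp only [Finset.mem_filter, Finset.mem_univ, true_and] at this
      exact this
    simp only [Finset.mem_coe, Finset.mem_product, Finset.mem_filter, Finset.mem_univ, true_and]
    refine ⟨?_, fun i hi => by rw [if_neg hi]⟩
    intro h0
    have h := congr_fun hρ' i₀
    rw [spAct_apply, h0, mul_zero] at h
    exact hi₀ h.symm
  · intro ρ hρ ρ' hρ' h
    have e₁ : spAct ρ x = x := by
      have := Finset.mem_coe.mp hρ
      simp only [Finset.mem_filter, Finset.mem_univ, true_and] at this
      exact this
    have e₂ : spAct ρ' x = x := by
      have := Finset.mem_coe.mp hρ'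
      simp only [Finset.mem_filter, Finset.mem_univ, true_and] at this
      exact this
    simp only [Prod.mk.injEq] at h
    obtain ⟨h₁, h₂⟩ := h
    refine Prod.ext h₁ (funext fun i => ?_)
    have hi := congr_fun h₂ i
    by_cases hxi : x i = 0
    · simpa only [hxi, if_true] using hi
    · have e := congr_fun e₁ i
      have e' := congr_fun e₂ i
      rw [spAct_apply] at e e'
      rw [← h₁] at e'
      have hne : x (ρ.1 i) ≠ 0 := by
        intro h0; rw [h0, mul_zero] at e; exact hxi e.symm
      have hint : (ρ.2 i : ℤ) = (ρ'.2 i : ℤ) := by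
        apply mul_right_cancel₀ hne
        rw [e, e']
      exact Units.ext hint

/-- `d · #{π : x_{π i₀} ≠ 0} = #supp(x) · d!`: the fibres of `π ↦ π i₀` over the support.
[folklore] -/
theorem mul_card_perm_support (x : Fin d → ℤ) (i₀ : Fin d) :
    d * (univ.filter fun τ : Equiv.Perm (Fin d) => x (τ i₀) ≠ 0).card =
      (univ.filter fun i : Fin d => x i ≠ 0).card * d.factorial := by
  have hmaps : Set.MapsTo (fun τ : Equiv.Perm (Fin d) => τ i₀)
      (↑(univ.filter fun τ : Equiv.Perm (Fin d) => x (τ i₀) ≠ 0))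
      (↑(univ.filter fun i : Fin d => x i ≠ 0)) := by
    intro τ hπ
    have := Finset.mem_coe.mp hπ
    simp only [Finset.mem_filter, Finset.mem_univ, true_and] at this
    simp only [Finset.mem_coe, Finset.mem_filter, Finset.mem_univ, true_and]
    exact this
  rw [Finset.card_eq_sum_card_fiberwise hmaps, Finset.mul_sum]
  have hsum : ∀ j ∈ (univ.filter fun i : Fin d => x i ≠ 0),
      d * ((univ.filter fun τ : Equiv.Perm (Fin d) => x (τ i₀) ≠ 0).filter
        fun τ => τ i₀ = j).card = d.factorial := by
    intro j hj
    simp only [Finset.mem_filter, Finset.mem_univ, true_and] at hj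
    have hfib : ((univ.filter fun τ : Equiv.Perm (Fin d) => x (τ i₀) ≠ 0).filter
        fun τ => τ i₀ = j) = univ.filter fun τ : Equiv.Perm (Fin d) => τ i₀ = j := by
      ext τ
      simp only [Finset.mem_filter, Finset.mem_univ, true_and, and_iff_right_iff_imp]
      intro h; rw [h]; exact hj
    rw [hfib, card_perm_fin_apply_eq, mul_card_perm_fin_fix]
  refine (Finset.sum_congr rfl hsum).trans ?_
  rw [Finset.sum_const, smul_eq_mul]

/-- Sign vectors equal to `1` on the support of `x` inject into the subsets of its zero set:
`#{δ : δ = 1 on supp x} ≤ 2^{#zeros(x)}`. [folklore] -/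
theorem card_signs_fixed_le (x : Fin d → ℤ) :
    (univ.filter fun δ : Fin d → ℤˣ => ∀ i, x i ≠ 0 → δ i = 1).card ≤
      2 ^ (univ.filter fun i : Fin d => ¬ x i ≠ 0).card := by
  rw [← Finset.card_powerset]
  refine Finset.card_le_card_of_injOn (fun δ => univ.filter fun i => δ i = -1) ?_ ?_
  · intro δ hδ
    have hδ' := Finset.mem_coe.mp hδ
    simp only [Finset.mem_filter, Finset.mem_univ, true_and] at hδ'
    rw [Finset.mem_coe, Finset.mem_powerset]
    intro i hi
    simp only [Finset.mem_filter, Finset.mem_univ, true_and] at hi ⊢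
    intro hxi
    rw [hδ' i hxi] at hi
    exact absurd hi (by decide)
  · intro δ _ δ' _ h
    funext i
    have hi : δ i = -1 ↔ δ' i = -1 := by
      have := Finset.ext_iff.mp h i
      simpa only [Finset.mem_filter, Finset.mem_univ, true_and] using this
    rcases Int.units_eq_one_or (δ i) with h1 | h1 <;>
      rcases Int.units_eq_one_or (δ' i) with h2 | h2
    · rw [h1, h2]
    · exact absurd (hi.mpr h2) (by rw [h1]; decide)
    · exact absurd (hi.mp h1) (by rw [h2]; decide)
    · rw [h1, h2]

/-- **Stabiliser count.** For `x ≠ 0`, `2d · #{ρ ∈ W_d : ρ x = x} ≤ 2^d · d!` — equivalently, the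
`W_d`-orbit of a nonzero lattice point has at least `2d` elements. [folklore] -/
theorem two_mul_card_stab_le (x : Fin d → ℤ) (hx : x ≠ 0) :
    2 * d * (univ.filter fun ρ : SgnPermPair d => spAct ρ x = x).card ≤ 2 ^ d * d.factorial := by
  obtain ⟨i₀, hi₀⟩ : ∃ i, x i ≠ 0 := by
    by_contra h
    push Not at h
    exact hx (funext h)
  have h1 := card_stab_le x i₀ hi₀
  have h2 := mul_card_perm_support x i₀
  have h3 := card_signs_fixed_le x
  have hS : (univ.filter fun i : Fin d => x i ≠ 0).card +
      (univ.filter fun i : Fin d => ¬ x i ≠ 0).card = d := by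
    have h := Finset.card_filter_add_card_filter_not (s := (univ : Finset (Fin d)))
      (fun i => x i ≠ 0)
    rw [Finset.card_univ, Fintype.card_fin] at h
    exact h
  have hs : 1 ≤ (univ.filter fun i : Fin d => x i ≠ 0).card :=
    Finset.card_pos.mpr ⟨i₀, by simp [hi₀]⟩
  generalize (univ.filter fun i : Fin d => x i ≠ 0).card = s at h2 hS hs
  generalize (univ.filter fun i : Fin d => ¬ x i ≠ 0).card = z at h3 hS
  generalize (univ.filter fun τ : Equiv.Perm (Fin d) => x (τ i₀) ≠ 0).card = a at h1 h2
  generalize (univ.filter fun δ : Fin d → ℤˣ => ∀ i, x i ≠ 0 → δ i = 1).card = b at h1 h3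
  -- `2s ≤ 2^s` for `s ≥ 1`
  have h4 : 2 * s ≤ 2 ^ s := by
    have key : ∀ t : ℕ, 2 * (t + 1) ≤ 2 ^ (t + 1) := fun t => by
      have ht : t < 2 ^ t := Nat.lt_two_pow_self
      rw [pow_succ]
      omega
    have := key (s - 1)
    rwa [Nat.sub_add_cancel hs] at this
  calc 2 * d * (univ.filter fun ρ : SgnPermPair d => spAct ρ x = x).card ≤ 2 * d * (a * b) := Nat.mul_le_mul_left _ h1
    _ = 2 * (d * a) * b := by ring
    _ = 2 * (s * d.factorial) * b := by rw [h2]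
    _ ≤ 2 * (s * d.factorial) * 2 ^ z := Nat.mul_le_mul_left _ h3
    _ = (2 * s) * 2 ^ z * d.factorial := by ring
    _ ≤ 2 ^ s * 2 ^ z * d.factorial := Nat.mul_le_mul_right _ (Nat.mul_le_mul_right _ h4)
    _ = 2 ^ d * d.factorial := by rw [← pow_add, hS]

/-! ### `L_0(x) ≤ 1/(2d)` and the `n = 0` cell sups of `K`, `U` -/

/-- **`L_0(x) ≤ 1/(2d)` for every `x ≠ 0`** (`d ≥ 1`; attained at `x = N e_i`). The `n = 0` blanket /
`Q`-cell bound that the sorted-monotone cell sups (`n ≥ 1`) do not cover. [folklore] -/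
theorem srwL_zero_le (hd : 1 ≤ d) (x : Fin d → ℤ) (hx : x ≠ 0) : srwL d 0 x ≤ 1 / (2 * d) := by
  have hd' : (0 : ℝ) < 2 * d := by
    have : (1 : ℝ) ≤ d := by exact_mod_cast hd
    linarith
  rw [srwL_zero_eq_card_stab hd x, div_le_div_iff₀ (by positivity) hd', one_mul]
  have h := two_mul_card_stab_le x hx
  calc ((univ.filter fun ρ : SgnPermPair d => spAct ρ x = x).card : ℝ) * (2 * d) = ((2 * d * (univ.filter fun ρ : SgnPermPair d => spAct ρ x = x).card : ℕ) : ℝ) := by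
        push_cast; ring
    _ ≤ ((2 ^ d * d.factorial : ℕ) : ℝ) := by exact_mod_cast h
    _ = 2 ^ d * (d.factorial : ℝ) := by push_cast; ring

/-- `W_{0,0}(x) ≤ 1/(2d)` for `x ≠ 0` (`W_{n,0} = L_n`). [folklore] -/
theorem srwW_zero_zero_le (hd : 1 ≤ d) (x : Fin d → ℤ) (hx : x ≠ 0) :
    srwW d 0 0 x ≤ 1 / (2 * d) := by
  rw [srwW_zero]; exact srwL_zero_le hd x hx

/-- **`n = 0` cell sup for `K`.** `K_{0,l}(x) ≤ √I_{0,2l}(0) · √(1/(2d))` for every `x ≠ 0`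
((5.9) and `srwL_zero_le`). [cite: FitznerVanDerHofstad2016NoBLE, (5.9) p. 1091] -/
theorem srwK_zero_le_of_ne_zero (hd : 1 ≤ d) (l : ℕ) (x : Fin d → ℤ) (hx : x ≠ 0) :
    srwK d 0 l x ≤ Real.sqrt (srwI d 0 (2 * l) 0) * Real.sqrt (1 / (2 * d)) :=
  (srwK_le_sqrt_srwI_mul_srwL (n := 0) (by omega) l x).trans
    (mul_le_mul_of_nonneg_left (Real.sqrt_le_sqrt (srwL_zero_le hd x hx)) (Real.sqrt_nonneg _))

/-- The same with a numerical bound `I_{0,2l}(0) ≤ A`. [folklore] -/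
theorem srwK_zero_le_of_le (hd : 1 ≤ d) (l : ℕ) {A : ℝ} (hA : srwI d 0 (2 * l) 0 ≤ A)
    (x : Fin d → ℤ) (hx : x ≠ 0) :
    srwK d 0 l x ≤ Real.sqrt A * Real.sqrt (1 / (2 * d)) :=
  (srwK_zero_le_of_ne_zero hd l x hx).trans
    (mul_le_mul_of_nonneg_right (Real.sqrt_le_sqrt hA) (Real.sqrt_nonneg _))

/-- **`K_{0,0}(x) ≤ √(1/(2d))` for every `x ≠ 0`** (`I_{0,0}(0) = 1`): the `n = l = 0` cell of
`BoundH[4]`; at `d = 11` this is `1/√22`, the tables' node value at `3e₁`. [folklore] -/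
theorem srwK_zero_zero_le_of_ne_zero (hd : 1 ≤ d) (x : Fin d → ℤ) (hx : x ≠ 0) :
    srwK d 0 0 x ≤ Real.sqrt (1 / (2 * d)) := by
  have h := srwK_zero_le_of_ne_zero hd 0 x hx
  rw [mul_zero, srwI_zero_zero_apply, if_pos rfl, Real.sqrt_one, one_mul] at h
  exact h

/-- **`n = 0` cell sup for `U`.** `U_{0,l}(x) ≤ √V_{0,2l} · √(1/(2d))` for every `x ≠ 0`
((5.9) and `srwL_zero_le`). [cite: FitznerVanDerHofstad2016NoBLE, (5.9) p. 1091] -/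
theorem srwU_zero_le_of_ne_zero (hd : 1 ≤ d) (l : ℕ) (x : Fin d → ℤ) (hx : x ≠ 0) :
    srwU d 0 l x ≤ Real.sqrt (srwV d 0 (2 * l)) * Real.sqrt (1 / (2 * d)) :=
  (srwU_le_sqrt_srwV_mul_srwL (n := 0) (by omega) l x).trans
    (mul_le_mul_of_nonneg_left (Real.sqrt_le_sqrt (srwL_zero_le hd x hx)) (Real.sqrt_nonneg _))

/-- The same with a numerical bound `V_{0,2l} ≤ V'`. [folklore] -/
theorem srwU_zero_le_of_le (hd : 1 ≤ d) (l : ℕ) {V' : ℝ} (hV : srwV d 0 (2 * l) ≤ V')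
    (x : Fin d → ℤ) (hx : x ≠ 0) :
    srwU d 0 l x ≤ Real.sqrt V' * Real.sqrt (1 / (2 * d)) :=
  (srwU_zero_le_of_ne_zero hd l x hx).trans
    (mul_le_mul_of_nonneg_right (Real.sqrt_le_sqrt hV) (Real.sqrt_nonneg _))

end Literature.Probability.FitznerVanDerHofstad2017
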